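import Summits.CriticalPhenomena.CardyFormulaZ2.Theses.CardySelfRefinement
import Summits.CriticalPhenomena.CardyFormulaZ2.Theorems.CardySelfRefinementSymmetryUpgradeROfConjecture
import Summits.CriticalPhenomena.CardyFormulaZ2.Theorems.CardySelfRefinementSymmetryUpgradeRZhouDefs
import HarnessLib

/-!
# Line skeleton `zhou-class-seam` for crux `SymmetryUpgradeR` (stmt-CriticalPhenomena-17239,
# route `CardySelfRefinement`) — crux-strategist ALTERNATIVE (decomposition) line, s1, 2026-08-17

A DECOMPOSITION line, registered ALONGSIDE the live line `zhou-rotation-split-audit` (never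
overwriting it): its two stubs are the two children of the glued split designed in
`Cruxes/SymmetryUpgradeR/STRATEGY-CENSUS.md` §D1 and proved to imply the crux in
`Cruxes/SymmetryUpgradeR/SplitGlue.lean` (`Split.SymmetryUpgradeR_of_subs`, sorry-free over the
landed sandwich `symmetryUpgradeR_of_sle6LimitZ2AllDiscretisations`).  The route-level filing
(`ledger route edit … --split SymmetryUpgradeR --into children.json --glue-by …SymmetryUpgradeR_of_subs`)
was refused to this seat ("--split is available on a seat's FINAL cycle only") and is left to the
tenure planner / a final-cycle lead; `children.json` is in the card `Lines/zhou-class-seam.md`.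

* `stub_zhouClassSLESix : SLESixOnZhouClass` — SLE₆ along ONE admissible square-lattice
  discretisation family on every convex-corner-marked rectilinear Dobrushin polygon (W. Zhou,
  arXiv:2409.03235 v6, Thm 2, read on tree-admissible data; `ZhouDefs`, p153813).  This is the
  live line's internal waypoint: its `stub_halfCR ∧ stub_rotationSplit ∧ stub_halfPlaneOneArm ∧
  stub_zhouBackEnd` prove it verbatim, and so would any other lattice mechanism for the missing
  Cauchy–Riemann half followed by the tree's `κ = 6` martingale layer
  (`Literature/…/ParaObservableLocalMartingale.lean`, `ParaObservableFarField.lean`; census §T5/§D2).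
  THE WHOLE OPEN CONTENT sits here (census §D1: "which piece remains the crux").
* `stub_zhouClassToAllDomains : SLESixOnZhouClass → SLE6LimitZ2AllDiscretisations` — the RSW
  patch (marks/arcs insensitivity, Radó approximation, collar coupling with the half-plane
  three-arm exponent `2 > 1`, Carathéodory continuity of the SLE₆ law, Aizenman–Burchard): SAME
  TEXT as the live line's registered `stub_allDomainsOfZhouClass` (one landing serves both), same
  content as crux 10814's `stub_allDomainsOfRectilinear`; the lead's landed
  `allDomainsOfZhouClass_of` (p156842) reduces it to two named inputs.  Technology, `L–XL`,
  independent of the bet — the stub this line exists to get STAFFED IN PARALLEL.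

Composition: `SymmetryUpgradeR_of : S1 → S2 → SymmetryUpgradeR` inlines `Split.SymmetryUpgradeR_of_zhouClass`
(sorry-free); `SymmetryUpgradeR_proof` instantiates it (its `sorryAx` closure = the two stubs).

Disproof used (`Cruxes/SymmetryUpgradeR/Disproof.lean`, `Negative/LoadBearing.lean` p133795):
`symmetryUpgradeR_false_without_clauseIV` honoured — clause (iv) is consumed, and is the only crux
hypothesis consumed, inside the sandwich at the end of `SymmetryUpgradeR_of`; F2/F3 (pinning):
the line identifies the pinned limit lattice-side, so `typedSchrammPrinciple_fails`
(Negative/TiltedRayFamily) does not bite (no stub mentions `ChordalFamily` axioms); F5 junk audit: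
both stubs quantify over admissible families (`ZdDiscretisationFamily`) and genuine Dobrushin
domains; the Zhou class is inhabited (`zhouClass_nonempty`, live skeleton §3), so S1 is not
vacuous and S2 does not silently carry the conjecture; negatives index (11 statements,
2026-08-17): none equal or near either stub.
-/

noncomputable section

namespace Summit.CriticalPhenomena.CardyFormulaZ2.Cruxes.SymmetryUpgradeR.ZhouClassSeam

open Summit.CriticalPhenomena.CardyFormulaZ2.Theorems.SymmetryUpgradeR.ZhouRotationSplitAudit
  (SLESixOnZhouClass)
open Summit.CriticalPhenomena.CardyFormulaZ2.Theorems.SymmetryUpgradeR.SwallowingSkeleton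
  (symmetryUpgradeR_of_sle6LimitZ2AllDiscretisations)

/-! ### §1 The registered stubs (sorries live ONLY here) -/

/-- Registered stub `stub_zhouClassSLESix` (S1 · THE OPEN CONTENT; Zhou arXiv:2409.03235 v6 Thm 2 on
tree-admissible data = the live line's waypoint, proved there by S1–S4).  For every Dobrushin domain
with rectilinear Jordan boundary and convex right-angle corners at both marks, SOME admissible
discretisation family has interfaces converging in law to chordal SLE₆.  Route-level copy (unfolded):
`Split.SLESixOnCornerMarkedRectilinear` (`Split.sleSixOnCornerMarkedRectilinear_iff`, `Iff.rfl`). -/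
theorem stub_zhouClassSLESix : SLESixOnZhouClass := by
  sorry

/-- Registered stub `stub_zhouClassToAllDomains` (S2 · RSW PATCH, L–XL, technology; same text as the
live line's `stub_allDomainsOfZhouClass`).  One SLE₆-convergent admissible family on every
corner-marked rectilinear polygon ⇒ Smirnov's Conjecture 4 at `q = 1` for every Dobrushin domain and
every admissible family.  Route-level copy with the conjecture body inlined:
`Split.RectilinearToAllDomains` (`Split.rectilinearToAllDomains_iff`, `Iff.rfl`). -/
theorem stub_zhouClassToAllDomains :
    SLESixOnZhouClass → Literature.Probability.Percolation.SLE6LimitZ2AllDiscretisations := by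
  sorry

/-! ### §2 Composition (sorry-free) -/

/-- **THE SKELETON THEOREM (arrow form).** S1 → S2 → crux BY NAME: S2 applied to S1 is Smirnov's
Conjecture 4 at `q = 1`; the LANDED sandwich `symmetryUpgradeR_of_sle6LimitZ2AllDiscretisations`
concludes (byte-identical mathematics with the strategist's `Split.SymmetryUpgradeR_of_zhouClass` /
`Split.SymmetryUpgradeR_of_subs` of `Cruxes/SymmetryUpgradeR/SplitGlue.lean`, inlined here so that the
skeleton imports library modules only).  No `sorry`. [folklore] -/
theorem SymmetryUpgradeR_of :
    SLESixOnZhouClass →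
    (SLESixOnZhouClass → Literature.Probability.Percolation.SLE6LimitZ2AllDiscretisations) →
    Summit.CriticalPhenomena.CardyFormulaZ2.Theses.CardySelfRefinement.SymmetryUpgradeR :=
  fun h₁ h₂ => symmetryUpgradeR_of_sle6LimitZ2AllDiscretisations (h₂ h₁)

/-- The crux BY NAME from the two registered stubs (its `sorryAx` closure is exactly the stubs). -/
theorem SymmetryUpgradeR_proof :
    Summit.CriticalPhenomena.CardyFormulaZ2.Theses.CardySelfRefinement.SymmetryUpgradeR :=
  SymmetryUpgradeR_of stub_zhouClassSLESix stub_zhouClassToAllDomains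

end Summit.CriticalPhenomena.CardyFormulaZ2.Cruxes.SymmetryUpgradeR.ZhouClassSeam

end
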